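import Summits.QuantumFields.YangMills.Theorems.BalabanUVNodesN20BlockCaricatureTVOrder

/-!
# BalabanUVNodes ∕ N20·N19′·N21 — THE ORDER OF THE CARICATURE'S COUNT ℓ¹, PART 2 (FILE J of the caricature series): the BULK regime `σ ≥ 1` (binomial anti-concentration
# via MY FILE H) and the two-sided ORDER `10⁻⁶·min(1, Δ∕max(1,σ)) ≤ ℓ ≤ 2√2·min(1, Δ∕max(1,σ))` for ALL `p, q ∈ [0,1]`, all `n` — `ℓ = Σ_k C(n,k)|q^k(1−q)^{n−k} − p^k(1−p)^{n−k}|`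
# (= 2·TV(Bin(n,p), Bin(n,q))), `Δ = n|q − p|`, `σ = √(n·max(p(1−p), q(1−q)))`

Cell `pub-ymgap` (HUMAN RULING D-0062 Track A; work-bound push D-0149, director-ym №197), width seat `pub-ymgap-dag-n20-w1` (gen 6) on node N20 = NE7b; key item K3⁷
`SpineGivenEndpointR13SepCoPH` = stmt-QuantumFields-20544 (`--kind proof --supports 20544 --as helper`); COUNT-NEUTRAL.  Bus: CLAIM-15 ∕ INTENT-20b (INBOX l.35172 ∕ l.35427).
THEOREMS ONLY: no `def`, no `instance`, no `notation`, no `sorry`; imports MY FILE I `…N20BlockCaricatureTVOrder` only (through it FILE H p622281, FILE F p618695, n19-w2 p615382).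

WHY.  The bulk regime is where CRIT-1's brackets (`Λ` vs `√Λ`, MY FILES C∕D∕G) are furthest apart and where no tree lemma decided the order: it needs a LOWER bound of de Moivre–Laplace
type for the binomial point mass near the mean (anti-concentration), supplied by FILE H from the tree's Stirling–Robbins letter.  The argument: at the larger-variance rate `a`
(reflected to `a ≤ ½`), the tail event `{S ≥ ⌊na⌋ + 1}` has rate-derivative `n·C(n−1,⌊na⌋)·r^{⌊na⌋}(1−r)^{n−1−⌊na⌋} ≥ n·K∕σ` for every `r` within `σ∕(4n)` of `a` (`K` an absolute
constant), so over the rate window of length `min(|b − a|, σ∕(4n))` next to `a` the two tail probabilities differ by `≥ (K∕4)·min(1, n|b−a|∕σ)` — and any event's gap is below `ℓ`.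
* §1 [folklore] `bulk_bookkeeping` (`n ≥ 4`, `1 ≤ σ ≤ nv`, `σ∕(4n) ≤ a∕4`, `1 ≤ ⌊na⌋ ≤ n − 2`) · ★ `deriv_floor_window` (the derivative floor `n·(e^{−1∕6}∕√(2π))·(√3∕(2σ))·e^{−9}` on the
  window: FILE H `binomialPMF_ge_local` at `N = n−1` with `|k − (n−1)r| ≤ 2 + σ∕4`, `(n−1)r(1−r) ≥ (9∕16)σ²`, `k(n−1−k) ≤ nσ²`).
* §2 [folklore] ★★★ `l1Count_ge_bulk_core` (`0 < a ≤ ½`, `1 ≤ n·a(1−a)`, any `b ∈ [0,1]`: `(K∕4)·min(1, n|b−a|∕σ_a) ≤ ℓ`; FILE H `mul_sub_le_binomTail_sub` ∕ `binomTail_sub_le_of_Icc` ∕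
  `abs_binomTail_sub_le_l1Count`) · `bulkConst_ge` (`10⁻⁶ ≤ K∕4`, from `e ≤ 2.7182818286`, `π ≤ 3.15`).
* §3 [folklore] ★★★ `l1Count_ge_order` (`10⁻⁶·min(1, Δ∕max(1,σ)) ≤ ℓ` for all `p, q ∈ [0,1]`: FILE I's rare bound, or §2 at the larger-variance rate reflected by FILE I `l1Count_reflect`) ·
  ★★★★ `l1Count_order` (the two-sided ORDER, with FILE I `l1Count_le_order`).

HONEST FRAMING.  [folklore] finite-sum probability ∕ real analysis about the binomial law (Feller I §VII; constants from Robbins via the tree) on a CARICATURE (independent level-1 blocks,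
product Bernoulli class weights — the card's own simplification); NOTHING read at the record (`classSet₁₃ ∕ weightA₁₃ ∕ weightB₁₃` untouched; (LS)∕(XG′)∕(SAT′) at the record UNDECIDED);
proves NO estimate of Bałaban's; refutes NO registered stub; nothing of Bałaban's asserted or instantiated.  NE7 ∕ NE7b ∕ NE7c NOT PRINTED for `d = 4`, NOT proved; N19 ∕ N20 ∕ N21 NOT
discharged; K3⁷ OPEN, skeleton v5 941dddb108cbaacf STANDS; counts unmoved (typed 28∕28 · discharged 5∕27); no count claim.  One finite `𝕋⁴` programme at fixed `ε`, Bałaban AS PRINTED;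
the YM mass gap (Clay) is NOT proved by any of this — R4 closes the conditional finite-𝕋⁴ rung `BalabanLadder.UV` only; NOT ℝ⁴, NOT OS.  No decl carries a cite tag.
-/

set_option autoImplicit false

noncomputable section

open Finset
open Literature.Probability.Distributions.ExponentialOrderStatistics (binomTail)
open Summit.QuantumFields.YangMills.BalabanUVNodes.N20BinomialLocalBound
open Summit.QuantumFields.YangMills.BalabanUVNodes.N20BlockCaricatureTVOrder

namespace Summit.QuantumFields.YangMills.BalabanUVNodes.N20BlockCaricatureTVOrderBulk

/-! ## §1 The bulk regime `σ ≥ 1`: the derivative floor on the rate window [folklore] -/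

section Window

variable {a : ℝ} {n : ℕ}

/-- Bookkeeping of the bulk regime at the larger-variance rate `a ≤ ½` (`v = a(1−a)`, `σ = √(n v) ≥ 1`): `n ≥ 4`, `σ ≤ n v`, `σ∕(4n) ≤ a∕4`, `1 ≤ ⌊n a⌋`, `⌊n a⌋ + 2 ≤ n`. [folklore] -/
theorem bulk_bookkeeping (ha0 : 0 < a) (ha : a ≤ 1 / 2) (hbulk : 1 ≤ n * (a * (1 - a))) :
    (4 : ℝ) ≤ n ∧ 1 ≤ Real.sqrt (n * (a * (1 - a))) ∧ Real.sqrt (n * (a * (1 - a))) ≤ n * (a * (1 - a)) ∧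
      Real.sqrt (n * (a * (1 - a))) / (4 * n) ≤ a / 4 ∧ 1 ≤ ⌊(n : ℝ) * a⌋₊ ∧ ⌊(n : ℝ) * a⌋₊ + 2 ≤ n := by
  set v := a * (1 - a) with hv
  set σ := Real.sqrt (n * v) with hσ
  have hv4 : v ≤ 1 / 4 := by nlinarith [sq_nonneg (2 * a - 1)]
  have hva : v ≤ a := by nlinarith
  have hn0 : (0 : ℝ) ≤ n := Nat.cast_nonneg n
  have hn4 : (4 : ℝ) ≤ n := by nlinarith
  have hσ1 : 1 ≤ σ := Real.one_le_sqrt.2 hbulk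
  have hσ2 : σ ^ 2 = n * v := Real.sq_sqrt (by linarith)
  have hσnv : σ ≤ n * v := by nlinarith
  have hδ : σ / (4 * n) ≤ a / 4 := by
    rw [div_le_div_iff₀ (by linarith) (by norm_num)]
    nlinarith
  have hna : (1 : ℝ) ≤ n * a := le_trans hbulk (by nlinarith)
  have hk1 : 1 ≤ ⌊(n : ℝ) * a⌋₊ := Nat.floor_pos.2 hna
  have hk2 : ⌊(n : ℝ) * a⌋₊ + 2 ≤ n := by
    have h1 : (⌊(n : ℝ) * a⌋₊ : ℝ) ≤ n * a := Nat.floor_le (by nlinarith)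
    have h2 : (n : ℝ) * a ≤ n / 2 := by nlinarith
    have h3 : ((⌊(n : ℝ) * a⌋₊ + 2 : ℕ) : ℝ) ≤ n := by push_cast; linarith
    exact_mod_cast h3
  exact ⟨hn4, hσ1, hσnv, hδ, hk1, hk2⟩
set_option maxHeartbeats 400000 in
/-- ★ **THE DERIVATIVE FLOOR ON THE WINDOW** [folklore]: in the bulk regime at the larger-variance rate `a ≤ ½` (`v = a(1−a)`, `σ = √(nv) ≥ 1`), with an integer `k` within
one of `na` from below (`na − 1 ≤ k ≤ na`, e.g. `k = ⌊na⌋`), for every rate `r` within `σ∕(4n)` of `a` and with `r(1−r) ≥ ¾·v`: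
`n·(e^{−1∕6}∕√(2π))·(√3∕(2σ))·e^{−9} ≤ n·C(n−1,k)·r^k·(1−r)^{n−1−k}` (FILE H `binomialPMF_ge_local` at `N = n−1`; `|k − (n−1)r| ≤ 2 + σ∕4`, `(n−1)r(1−r) ≥ (9∕16)σ²`,
`k(n−1−k) ≤ nσ²`). -/
theorem deriv_floor_window (ha0 : 0 < a) (ha : a ≤ 1 / 2) (hbulk : 1 ≤ n * (a * (1 - a))) {k : ℕ} (hk1 : 1 ≤ k) (hk2 : k + 2 ≤ n)
    (hkle : (k : ℝ) ≤ n * a) (hkge : (n : ℝ) * a - 1 ≤ k) {r : ℝ} (hr0 : 0 < r) (hr1 : r < 1)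
    (hra : |r - a| ≤ Real.sqrt (n * (a * (1 - a))) / (4 * n)) (hrv : 3 / 4 * (a * (1 - a)) ≤ r * (1 - r)) :
    n * (Real.exp (-(1 / 6)) / Real.sqrt (2 * Real.pi) * (Real.sqrt 3 / (2 * Real.sqrt (n * (a * (1 - a))))) * Real.exp (-9)) ≤
      n * (((n - 1).choose k : ℝ) * r ^ k * (1 - r) ^ (n - 1 - k)) := by
  obtain ⟨hn4, hσ1, hσnv, hδ, -, -⟩ := bulk_bookkeeping ha0 ha hbulk
  have hn0 : (0 : ℝ) < n := by linarith
  have hv0 : 0 < a * (1 - a) := by nlinarith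
  have hσ0 : 0 < Real.sqrt (n * (a * (1 - a))) := by linarith
  have hσ2 : Real.sqrt (n * (a * (1 - a))) ^ 2 = n * (a * (1 - a)) := Real.sq_sqrt (by positivity)
  have hkN : k + 1 ≤ n - 1 := by omega
  have hN : ((n - 1 : ℕ) : ℝ) = n - 1 := by rw [Nat.cast_sub (by omega)]; simp
  -- the local bound
  have hloc := binomialPMF_ge_local (N := n - 1) (k := k) hk1 hkN hr0 hr1
  rw [hN] at hloc
  -- (i) |k − (n−1) r| ≤ 2 + σ/4
  have hnδ : (n : ℝ) * (Real.sqrt (n * (a * (1 - a))) / (4 * n)) = Real.sqrt (n * (a * (1 - a))) / 4 := by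
    field_simp
  have hra' := abs_le.1 hra
  have hup : (k : ℝ) - (n - 1) * r ≤ 2 + Real.sqrt (n * (a * (1 - a))) / 4 := by nlinarith
  have hlo : -(2 + Real.sqrt (n * (a * (1 - a))) / 4) ≤ (k : ℝ) - (n - 1) * r := by nlinarith
  have hdev : ((k : ℝ) - (n - 1) * r) ^ 2 ≤ (2 + Real.sqrt (n * (a * (1 - a))) / 4) ^ 2 := sq_le_sq' hlo hup
  -- (ii) (n−1) r (1−r) ≥ (9/16) σ²
  have h34n : 3 / 4 * (n : ℝ) ≤ n - 1 := by linarith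
  have hNvar : 9 / 16 * Real.sqrt (n * (a * (1 - a))) ^ 2 ≤ (n - 1) * r * (1 - r) := by
    rw [hσ2]
    have h1 : 3 / 4 * (n : ℝ) * (3 / 4 * (a * (1 - a))) ≤ (n - 1) * (r * (1 - r)) :=
      mul_le_mul h34n hrv (by positivity) (by linarith)
    linarith
  have h1r : 0 < 1 - r := by linarith
  have hNvar0 : 0 < ((n : ℝ) - 1) * r * (1 - r) := by
    have : (0 : ℝ) < n - 1 := by linarith
    positivity
  -- exponent ≤ 9 (uses σ ≥ 1)
  have hexp : Real.exp (-9) ≤ Real.exp (-(((k : ℝ) - (n - 1) * r) ^ 2 / ((n - 1) * r * (1 - r)))) := by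
    rw [Real.exp_le_exp, neg_le_neg_iff, div_le_iff₀ hNvar0]
    nlinarith
  -- (iv) √((n−1)/(k(n−1−k))) ≥ √3/(2σ)
  have hkpos : (0 : ℝ) < k := by exact_mod_cast hk1
  have hNk : (0 : ℝ) < (n : ℝ) - 1 - k := by
    have : ((k + 2 : ℕ) : ℝ) ≤ n := by exact_mod_cast hk2
    push_cast at this; linarith
  have hprod : (k : ℝ) * ((n : ℝ) - 1 - k) ≤ n * Real.sqrt (n * (a * (1 - a))) ^ 2 := by
    rw [hσ2]
    have h1 : (n : ℝ) - 1 - k ≤ n * (1 - a) := by linarith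
    have h2 : (0 : ℝ) ≤ n * a := by positivity
    calc (k : ℝ) * ((n : ℝ) - 1 - k) ≤ (n * a) * (n * (1 - a)) := mul_le_mul hkle h1 hNk.le h2
      _ = n * (n * (a * (1 - a))) := by ring
  have hsq : Real.sqrt 3 / (2 * Real.sqrt (n * (a * (1 - a)))) ≤ Real.sqrt ((n - 1) / (k * ((n : ℝ) - 1 - k))) := by
    have h34 : 3 / (4 * Real.sqrt (n * (a * (1 - a))) ^ 2) ≤ (n - 1) / (k * ((n : ℝ) - 1 - k)) := by
      rw [div_le_div_iff₀ (by positivity) (by positivity)]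
      nlinarith
    calc Real.sqrt 3 / (2 * Real.sqrt (n * (a * (1 - a)))) = Real.sqrt (3 / (4 * Real.sqrt (n * (a * (1 - a))) ^ 2)) := by
          rw [Real.sqrt_div (by norm_num : (0:ℝ) ≤ 3), show 4 * Real.sqrt (n * (a * (1 - a))) ^ 2 = (2 * Real.sqrt (n * (a * (1 - a)))) ^ 2 by ring,
            Real.sqrt_sq (by linarith)]
      _ ≤ _ := Real.sqrt_le_sqrt h34
  -- assemble
  have hc0 : 0 ≤ Real.exp (-(1 / 6)) / Real.sqrt (2 * Real.pi) := by positivity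
  have step : Real.exp (-(1 / 6)) / Real.sqrt (2 * Real.pi) * (Real.sqrt 3 / (2 * Real.sqrt (n * (a * (1 - a))))) * Real.exp (-9) ≤
      Real.exp (-(1 / 6)) / Real.sqrt (2 * Real.pi) * Real.sqrt ((n - 1) / (k * ((n : ℝ) - 1 - k))) *
        Real.exp (-(((k : ℝ) - (n - 1) * r) ^ 2 / ((n - 1) * r * (1 - r)))) :=
    mul_le_mul (mul_le_mul_of_nonneg_left hsq hc0) hexp (Real.exp_pos _).le (by positivity)
  have hfin := mul_le_mul_of_nonneg_left (step.trans hloc) hn0.le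
  calc _ ≤ (n : ℝ) * (((n - 1).choose k : ℝ) * r ^ k * (1 - r) ^ (n - 1 - k)) := hfin

end Window

/-! ## §2 The bulk regime: the tail event over the rate window [folklore] -/

section Bulk

variable {a b : ℝ} {n : ℕ}

/-- ★★★ **BULK REGIME AT ONE RATE**: `0 < a ≤ ½`, `1 ≤ n·a(1−a)` (`σ_a := √(n·a(1−a)) ≥ 1`), any `b ∈ [0,1]`:
`(K∕4)·min(1, n|b − a|∕σ_a) ≤ ℓ`, `K = (e^{−1∕6}∕√(2π))·(√3∕2)·e^{−9}`.  The tail event `{S ≥ ⌊na⌋ + 1}` separates the two count laws by at least its derivative floor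
(`deriv_floor_window`) times the length `min(|b − a|, σ_a∕(4n))` of the rate window next to `a` (FILE H `mul_sub_le_binomTail_sub`, `binomTail_sub_le_of_Icc`, `abs_binomTail_sub_le_l1Count`). -/
theorem l1Count_ge_bulk_core (ha0 : 0 < a) (ha : a ≤ 1 / 2) (hb0 : 0 ≤ b) (hb1 : b ≤ 1) (hbulk : 1 ≤ n * (a * (1 - a))) :
    Real.exp (-(1 / 6)) / Real.sqrt (2 * Real.pi) * (Real.sqrt 3 / 2) * Real.exp (-9) / 4 *
        min 1 (n * |b - a| / Real.sqrt (n * (a * (1 - a)))) ≤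
      ∑ k ∈ Finset.range (n + 1), (n.choose k : ℝ) * |b ^ k * (1 - b) ^ (n - k) - a ^ k * (1 - a) ^ (n - k)| := by
  obtain ⟨hn4, hσ1, hσnv, hδ, hk1, hk2⟩ := bulk_bookkeeping ha0 ha hbulk
  set σ := Real.sqrt (n * (a * (1 - a))) with hσ_def
  set K := Real.exp (-(1 / 6)) / Real.sqrt (2 * Real.pi) * (Real.sqrt 3 / 2) * Real.exp (-9) with hK_def
  have hn0 : (0 : ℝ) < n := by linarith
  have hσ0 : 0 < σ := by linarith
  have hK0 : 0 < K := by positivity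
  have hδ0 : 0 < σ / (4 * n) := by positivity
  have hδa : σ / (4 * n) ≤ a / 4 := hδ
  -- the integer `k = ⌊na⌋` (kept opaque)
  obtain ⟨k, hk⟩ : ∃ k : ℕ, k = ⌊(n : ℝ) * a⌋₊ := ⟨_, rfl⟩
  have hk1' : 1 ≤ k := hk ▸ hk1
  have hk2' : k + 2 ≤ n := hk ▸ hk2
  have hkle : (k : ℝ) ≤ n * a := hk ▸ Nat.floor_le (by positivity)
  have hkge : (n : ℝ) * a - 1 ≤ k := by have := Nat.lt_floor_add_one ((n : ℝ) * a); rw [← hk] at this; linarith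
  have hm1 : 1 ≤ k + 1 := by omega
  have hmn : k + 1 ≤ n := by omega
  -- the derivative floor in the `m = k + 1` form FILE H expects
  have hfloor : ∀ r : ℝ, 0 < r → r < 1 → |r - a| ≤ σ / (4 * n) → 3 / 4 * (a * (1 - a)) ≤ r * (1 - r) →
      n * K / σ ≤ (n : ℝ) * ((n - 1).choose (k + 1 - 1) : ℝ) * r ^ (k + 1 - 1) * (1 - r) ^ (n - (k + 1)) := by
    intro r hr0 hr1 hra hrv
    have h := deriv_floor_window ha0 ha hbulk hk1' hk2' hkle hkge hr0 hr1 hra hrv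
    rw [Nat.add_sub_cancel, show n - (k + 1) = n - 1 - k by omega]
    have e : (n : ℝ) * K / σ = n * (Real.exp (-(1 / 6)) / Real.sqrt (2 * Real.pi) * (Real.sqrt 3 / (2 * σ)) * Real.exp (-9)) := by
      rw [hK_def]; field_simp
    rw [e]
    calc _ ≤ (n : ℝ) * (((n - 1).choose k : ℝ) * r ^ k * (1 - r) ^ (n - 1 - k)) := h
      _ = _ := by ring
  -- the tail step on the window: `(nK/σ)·min(|b−a|, δ) ≤ ℓ`
  have hmain : n * K / σ * min |b - a| (σ / (4 * n)) ≤
      ∑ k ∈ Finset.range (n + 1), (n.choose k : ℝ) * |b ^ k * (1 - b) ^ (n - k) - a ^ k * (1 - a) ^ (n - k)| := by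
    rcases lt_trichotomy b a with hba | rfl | hab
    · -- b < a: window [max b (a − δ), a]
      set lo := max b (a - σ / (4 * n)) with hlo
      have hlo_a : lo ≤ a := max_le hba.le (by linarith)
      have hlo_b : b ≤ lo := le_max_left _ _
      have hlo_δ : a - σ / (4 * n) ≤ lo := le_max_right _ _
      have hstep := mul_sub_le_binomTail_sub hm1 hmn hlo_a (C := n * K / σ) fun r hr1 hr2 =>
        hfloor r (by linarith) (by linarith) (abs_le.2 ⟨by linarith, by linarith⟩)
          (by nlinarith [mul_le_mul (show 3 / 4 * a ≤ r by linarith) (show 1 - a ≤ 1 - r by linarith) (by linarith) (by linarith)])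
      have hsub := binomTail_sub_le_of_Icc hm1 hmn hb0 hlo_b hlo_a le_rfl (by linarith : a ≤ 1)
      have habs := abs_binomTail_sub_le_l1Count b a n (k + 1)
      rw [l1Count_swap] at habs
      have hlen : min |b - a| (σ / (4 * n)) = a - lo := by
        rw [abs_sub_comm, abs_of_pos (sub_pos.2 hba), hlo]
        rcases le_total b (a - σ / (4 * n)) with h | h
        · rw [max_eq_right h, min_eq_right (by linarith)]; ring
        · rw [max_eq_left h, min_eq_left (by linarith)]
      rw [hlen]
      linarith [le_abs_self (binomTail n (k + 1) a - binomTail n (k + 1) b)]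
    · rw [sub_self, abs_zero, min_eq_left hδ0.le, mul_zero]
      exact l1Count_nonneg b b n
    · -- a < b: window [a, min b (a + δ)]
      set hi := min b (a + σ / (4 * n)) with hhi
      have ha_hi : a ≤ hi := le_min hab.le (by linarith)
      have hhi_b : hi ≤ b := min_le_left _ _
      have hhi_δ : hi ≤ a + σ / (4 * n) := min_le_right _ _
      have hstep := mul_sub_le_binomTail_sub hm1 hmn ha_hi (C := n * K / σ) fun r hr1 hr2 =>
        hfloor r (by linarith) (by linarith) (abs_le.2 ⟨by linarith, by linarith⟩)
          (by nlinarith [mul_le_mul (show a ≤ r by linarith) (show 3 / 4 * (1 - a) ≤ 1 - r by linarith) (by linarith) (by linarith)])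
      have hsub := binomTail_sub_le_of_Icc hm1 hmn ha0.le le_rfl ha_hi hhi_b hb1
      have habs := abs_binomTail_sub_le_l1Count a b n (k + 1)
      have hlen : min |b - a| (σ / (4 * n)) = hi - a := by
        rw [abs_of_pos (sub_pos.2 hab), hhi]
        rcases le_total b (a + σ / (4 * n)) with h | h
        · rw [min_eq_left h, min_eq_left (by linarith)]
        · rw [min_eq_right h, min_eq_right (by linarith)]; ring
      rw [hlen]
      linarith [le_abs_self (binomTail n (k + 1) b - binomTail n (k + 1) a)]
  -- `(K/4)·min(1, n|b−a|/σ) ≤ (nK/σ)·min(|b−a|, σ/(4n))`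
  have hcmp : K / 4 * min 1 (n * |b - a| / σ) ≤ n * K / σ * min |b - a| (σ / (4 * n)) := by
    have hx0 : 0 ≤ (n : ℝ) * |b - a| / σ := by positivity
    rcases le_total |b - a| (σ / (4 * n)) with h | h
    · rw [min_eq_left h]
      have hx : (n : ℝ) * |b - a| / σ ≤ 1 := by
        rw [div_le_one hσ0]
        calc (n : ℝ) * |b - a| ≤ n * (σ / (4 * n)) := mul_le_mul_of_nonneg_left h hn0.le
          _ = σ / 4 := by field_simp
          _ ≤ σ := by linarith
      rw [min_eq_right hx]
      have : n * K / σ * |b - a| = K * (n * |b - a| / σ) := by field_simp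
      rw [this]
      nlinarith
    · rw [min_eq_right h]
      have : (n : ℝ) * K / σ * (σ / (4 * n)) = K / 4 := by field_simp
      rw [this]
      nlinarith [min_le_left (1 : ℝ) (n * |b - a| / σ)]
  exact hcmp.trans hmain

/-- `10⁻⁶ ≤ K∕4`, `K = (e^{−1∕6}∕√(2π))·(√3∕2)·e^{−9}` (`e ≤ 2.7182818286`, `π ≤ 3.15`, `√3 ≥ 1.7`). [folklore] -/
theorem bulkConst_ge : (1 / 1000000 : ℝ) ≤ Real.exp (-(1 / 6)) / Real.sqrt (2 * Real.pi) * (Real.sqrt 3 / 2) * Real.exp (-9) / 4 := by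
  have hE : (1 : ℝ) / 22027 ≤ Real.exp (-(1 / 6)) * Real.exp (-9) := by
    rw [← Real.exp_add]
    have h10 : Real.exp (-10) ≤ Real.exp (-(1 / 6) + -9) := Real.exp_le_exp.2 (by norm_num)
    refine le_trans ?_ h10
    have he := Real.exp_one_lt_d9
    have he0 : 0 < Real.exp 1 := Real.exp_pos 1
    have hpow : Real.exp 1 ^ 10 ≤ (2.7182818286 : ℝ) ^ 10 := pow_le_pow_left₀ he0.le he.le 10
    have hnum : (2.7182818286 : ℝ) ^ 10 ≤ 22027 := by norm_num
    have h10' : Real.exp 10 ≤ 22027 := by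
      rw [show (10 : ℝ) = ((10 : ℕ) : ℝ) by norm_num, ← Real.exp_one_pow]; exact hpow.trans hnum
    calc (1 : ℝ) / 22027 ≤ 1 / Real.exp 10 := one_div_le_one_div_of_le (Real.exp_pos 10) h10'
      _ = Real.exp (-10) := by rw [Real.exp_neg, one_div]
  have h3 : (17 / 10 : ℝ) ≤ Real.sqrt 3 := by
    rw [show (17 / 10 : ℝ) = Real.sqrt ((17 / 10) ^ 2) by rw [Real.sqrt_sq (by norm_num)]]
    exact Real.sqrt_le_sqrt (by norm_num)
  have hπ : Real.sqrt (2 * Real.pi) ≤ 26 / 10 := by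
    rw [show (26 / 10 : ℝ) = Real.sqrt ((26 / 10) ^ 2) by rw [Real.sqrt_sq (by norm_num)]]
    exact Real.sqrt_le_sqrt (by nlinarith [Real.pi_lt_d2])
  have hπ0 : 0 < Real.sqrt (2 * Real.pi) := by positivity
  have hAB : 1 / 22027 * (17 / 10) ≤ Real.exp (-(1 / 6)) * Real.exp (-9) * Real.sqrt 3 :=
    mul_le_mul hE h3 (by norm_num) (by positivity)
  rw [show Real.exp (-(1 / 6)) / Real.sqrt (2 * Real.pi) * (Real.sqrt 3 / 2) * Real.exp (-9) / 4 =
    Real.exp (-(1 / 6)) * Real.exp (-9) * Real.sqrt 3 / (8 * Real.sqrt (2 * Real.pi)) by field_simp; ring]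
  rw [le_div_iff₀ (by positivity)]
  nlinarith

end Bulk

/-! ## §3 The two-sided ORDER of the count ℓ¹ [folklore] -/

section Order

variable {p q : ℝ}

/-- ★★★ **LOWER ORDER**: for all `p, q ∈ [0,1]` and `n`, `10⁻⁶·min(1, Δ ∕ max(1, σ)) ≤ ℓ`, `Δ = n|q − p|`, `σ = √(n·max(p(1−p), q(1−q)))` (rare regime: FILE I `l1Count_ge_rare`;
bulk regime: `l1Count_ge_bulk_core` at the larger-variance rate, reflected to `≤ ½` by `l1Count_reflect`). -/
theorem l1Count_ge_order (hp0 : 0 ≤ p) (hp1 : p ≤ 1) (hq0 : 0 ≤ q) (hq1 : q ≤ 1) (n : ℕ) :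
    1 / 1000000 * min 1 (n * |q - p| / max 1 (Real.sqrt (n * max (p * (1 - p)) (q * (1 - q))))) ≤
      ∑ k ∈ Finset.range (n + 1), (n.choose k : ℝ) * |q ^ k * (1 - q) ^ (n - k) - p ^ k * (1 - p) ^ (n - k)| := by
  set v := max (p * (1 - p)) (q * (1 - q)) with hv_def
  have hn : (0 : ℝ) ≤ n := Nat.cast_nonneg n
  have hmin0 : ∀ x : ℝ, 0 ≤ x → 0 ≤ min 1 x := fun x hx => le_min zero_le_one hx
  rcases le_or_gt ((n : ℝ) * v) 1 with hrare | hbulk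
  · -- rare regime: `σ ≤ 1`
    have hσ : Real.sqrt (n * v) ≤ 1 := Real.sqrt_le_one.2 hrare |>.trans_eq' rfl
    rw [max_eq_left (Real.sqrt_le_one.2 hrare), div_one]
    have h := l1Count_ge_rare hp0 hp1 hq0 hq1 (n := n) hrare
    nlinarith [hmin0 (n * |q - p|) (by positivity)]
  · -- bulk regime at the larger-variance rate
    have hσ1 : 1 ≤ Real.sqrt (n * v) := Real.one_le_sqrt.2 hbulk.le
    rw [max_eq_right hσ1]
    have hK := bulkConst_ge
    have hgoal : ∀ {x ℓ : ℝ}, 0 ≤ x →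
        Real.exp (-(1 / 6)) / Real.sqrt (2 * Real.pi) * (Real.sqrt 3 / 2) * Real.exp (-9) / 4 * min 1 x ≤ ℓ → 1 / 1000000 * min 1 x ≤ ℓ :=
      fun hx h => le_trans (mul_le_mul_of_nonneg_right hK (hmin0 _ hx)) h
    rcases le_or_gt (p * (1 - p)) (q * (1 - q)) with hpq | hpq
    · -- the larger variance is `q`'s
      have hv : v = q * (1 - q) := max_eq_right hpq
      have hbq : 1 < (n : ℝ) * (q * (1 - q)) := by rw [← hv]; exact hbulk
      have hq0' : 0 < q := by
        rcases hq0.eq_or_lt with h | h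
        · rw [← h] at hbq; norm_num at hbq
        · exact h
      have hq1' : q < 1 := by
        rcases hq1.eq_or_lt with h | h
        · rw [h] at hbq; norm_num at hbq
        · exact h
      rw [hv]
      rcases le_or_gt q (1 / 2) with hq | hq
      · have h := l1Count_ge_bulk_core hq0' hq hp0 hp1 (n := n) hbq.le
        rw [← l1Count_swap p q n, abs_sub_comm p q] at h
        exact hgoal (by positivity) h
      · have h := l1Count_ge_bulk_core (a := 1 - q) (b := 1 - p) (n := n) (by linarith) (by linarith) (by linarith) (by linarith)
          (by rw [sub_sub_cancel, mul_comm (1 - q) q]; exact hbq.le)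
        rw [l1Count_reflect q p n, ← l1Count_swap p q n, sub_sub_cancel, show (1 - p) - (1 - q) = q - p by ring,
          mul_comm (1 - q) q] at h
        exact hgoal (by positivity) h
    · -- the larger variance is `p`'s
      have hv : v = p * (1 - p) := max_eq_left hpq.le
      have hbp : 1 < (n : ℝ) * (p * (1 - p)) := by rw [← hv]; exact hbulk
      have hp0' : 0 < p := by
        rcases hp0.eq_or_lt with h | h
        · rw [← h] at hbp; norm_num at hbp
        · exact h
      have hp1' : p < 1 := by
        rcases hp1.eq_or_lt with h | h
        · rw [h] at hbp; norm_num at hbp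
        · exact h
      rw [hv]
      rcases le_or_gt p (1 / 2) with hp | hp
      · have h := l1Count_ge_bulk_core hp0' hp hq0 hq1 (n := n) hbp.le
        exact hgoal (by positivity) h
      · have h := l1Count_ge_bulk_core (a := 1 - p) (b := 1 - q) (n := n) (by linarith) (by linarith) (by linarith) (by linarith)
          (by rw [sub_sub_cancel, mul_comm (1 - p) p]; exact hbp.le)
        rw [l1Count_reflect p q n, sub_sub_cancel, show (1 - q) - (1 - p) = -(q - p) by ring, abs_neg, mul_comm (1 - p) p] at h
        exact hgoal (by positivity) h

/-- ★★★★ **THE ORDER OF THE CARICATURE'S COUNT ℓ¹** [folklore]: for all `p, q ∈ [0,1]` and all `n`,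
`10⁻⁶·min(1, Δ∕max(1,σ)) ≤ Σ_{k ≤ n} C(n,k)·|q^k(1−q)^{n−k} − p^k(1−p)^{n−k}| ≤ 2√2·min(1, Δ∕max(1,σ))`, `Δ = n|q − p|` (mean count shift), `σ = √(n·max(p(1−p), q(1−q)))`
(the larger count s.d.): twice the total variation of `Bin(n,p)` vs `Bin(n,q)` is, up to absolute constants, the mean shift measured in units of `max(1, σ)`. -/
theorem l1Count_order (hp0 : 0 ≤ p) (hp1 : p ≤ 1) (hq0 : 0 ≤ q) (hq1 : q ≤ 1) (n : ℕ) :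
    1 / 1000000 * min 1 (n * |q - p| / max 1 (Real.sqrt (n * max (p * (1 - p)) (q * (1 - q))))) ≤
        ∑ k ∈ Finset.range (n + 1), (n.choose k : ℝ) * |q ^ k * (1 - q) ^ (n - k) - p ^ k * (1 - p) ^ (n - k)| ∧
      ∑ k ∈ Finset.range (n + 1), (n.choose k : ℝ) * |q ^ k * (1 - q) ^ (n - k) - p ^ k * (1 - p) ^ (n - k)| ≤
        2 * Real.sqrt 2 * min 1 (n * |q - p| / max 1 (Real.sqrt (n * max (p * (1 - p)) (q * (1 - q))))) :=
  ⟨l1Count_ge_order hp0 hp1 hq0 hq1 n, l1Count_le_order hp0 hp1 hq0 hq1 n⟩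

end Order

end Summit.QuantumFields.YangMills.BalabanUVNodes.N20BlockCaricatureTVOrderBulk

end
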